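import Literature.AlgebraicGeometry.AbelianSchemes.PolarizedTupleIsoRebase                 -- ★ (R1) `exists_tupleIso_baseChange_iff_comp`, `tupleRel_comp_id_id`
import Literature.AlgebraicGeometry.AbelianSchemes.TupleRelSymm                            -- ★ `exists_tupleRel_id_symm`
import Literature.AlgebraicGeometry.AbelianSchemes.TupleIsoSpecialInjectivityOfGeneric     -- ★ (GS-3) `exists_finset_forall_eq_of_tupleIsoAt`
import HarnessLib

/-!
# Transport of `tupleIsoAt`-injectivity along a POINTWISE reading of one PEL tuple by another (organ (GS-3d)∕(GS-3c)-core of the `stub_INJ0` payer)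

Topic `AlgebraicGeometry/AbelianSchemes`; namespace `Literature.AlgebraicGeometry.AbelianSchemes.AbelianSchemeOver`.  THEOREMS ONLY (no definition, no
instance, no notation, no named fact, no `sorry`); universe-polymorphic.  Cell `hodgecm-mathlib` (D-0151), P6 «MOD programme» (crux hLiu418 =
stmt-HodgeConjecture-24832, `--supports`, count-neutral); P-LINE ED. 2 leaf `Lines/F0_P6a_PELSpread.lean`, socket `stub_INJ0` (LEAD F0P6-plan (g3) «M-55»; A-p14
(g35) memo `MEMO-INJ0-CUT-stagefamily.v1` §1 «STAGE CUT»: the local spread `T` carries a POINTWISE special reading by the stage tuple).  HC_CM is proved only modulo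
the printed citations until rung 0 closes; nothing here is about HC.

THE MATHEMATICS ([MumfordFogartyKirwan1994] Ch. 7 §2 Def. 7.2, Prop. 7.3; §3 Thm. 7.9).  Let `ℓ : Z → Y`, a tuple `(𝒜, ι, Â, 𝒫, λ, lvl)` over `Y` and a tuple
`(𝒯, ι_T, 𝒯̂, 𝒫_T, λ_T, lvl_T)` over `Z` which is READ POINTWISE by `ℓ^*𝒜`: at every geometric point `x : Spec Ω → Z` the tuples `x^*𝒯` and `x^*ℓ^*𝒜` are
isomorphic (EXACT level, EXACT `λ`, Poincaré, `𝒪`-equivariant — the six clauses along `𝟙`).  Then «`𝒯` isomorphic at `(x₁, x₂)`» implies «`𝒜` isomorphic at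
`(x₁ ≫ ℓ, x₂ ≫ ℓ)`» (symmetry ★ `exists_tupleRel_id_symm` at the reduced connected Noetherian point, transitivity ★ `tupleRel_comp_id_id`, rebase ★ (R1)); hence
every INJECTIVITY statement «isomorphic at two geometric points centred over `s₀` ⇒ equal» for `𝒜` over `q : Y → S₀` descends to `𝒯` over `ℓ ≫ q` as soon as
`ℓ` is injective on geometric points (e.g. a monomorphism — the localisation leg `𝓨_(w) → 𝓨[1∕t]` of the P6a stage).  In particular the cofinite set of ★ (GS-3)
for ONE global stage family serves every local spread read pointwise by it — no rigidity transfer.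

* `exists_tupleIso_comp_of_pointwise` — the one-pair transport.
* `forall_eq_of_tupleIso_of_pointwise` — injectivity over a base point `s₀ : S₀` descends along a pointwise reading and a point-injective `ℓ`.
* `exists_finset_forall_eq_of_tupleIsoAt_of_pointwise` — HEAD: ★ (GS-3) for `𝒜` over `q : Y → Spec B` ⇒ its conclusion VERBATIM for `𝒯` over `ℓ ≫ q`.
* ED. 2: `exists_tupleIso_of_comp_of_pointwise` (converse one-pair transport), `forall_eq_of_tupleIso_of_pointwise_of_fac` (injectivity DESCENDS from `𝒯`
  to `𝒜` at the points over one base point that factor through `ℓ` — the `hgen₀` input of ★ (GS-3c′)).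

## References
* [MumfordFogartyKirwan1994] D. Mumford, J. Fogarty, F. Kirwan, *Geometric Invariant Theory*, 3rd ed. (1994), Ch. 7 §2 Def. 7.2 (p. 129), Prop. 7.3 (p. 132); §3 Thm. 7.9 (pp. 139–140).
* [GortzWedhorn2020] U. Görtz, T. Wedhorn, *Algebraic Geometry I*, 2nd ed. (2020), Section (4.7) (pp. 107–108).
* [RapoportSmithlingZhang2020Diagonal] M. Rapoport, B. Smithling, W. Zhang, Compos. Math. 156 (2020), §4.1 Thm. 4.1 (p. 17).
-/

set_option autoImplicit false

noncomputable section

-- Mathlib's `Over`/pull-back API is stated across semireducible wrappers (as in the ★ `AbelianSchemes/*` files).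
set_option backward.isDefEq.respectTransparency false

universe u

open CategoryTheory CategoryTheory.Limits AlgebraicGeometry

namespace Literature.AlgebraicGeometry.AbelianSchemes

namespace AbelianSchemeOver

section Transport

variable {Y Z : Scheme.{u}} (ℓ : Z ⟶ Y) {O : Type*} [CommRing O]
  (𝒜 : AbelianSchemeOver Y) (ρ : RingAction O 𝒜) (D : 𝒜.DualPair) (pol : 𝒜.Polarization D) {g N : ℕ} (lvl : 𝒜.LevelStructure g N)
  (𝒯 : AbelianSchemeOver Z) (ρT : RingAction O 𝒯) (DT : 𝒯.DualPair) (polT : 𝒯.Polarization DT) (lvlT : 𝒯.LevelStructure g N)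

/-- **ONE-PAIR TRANSPORT ALONG A POINTWISE READING.**  If at the field points `x₁, x₂ : Spec Ω → Z` the tuple `xᵢ^*𝒯` is isomorphic to `xᵢ^*(ℓ^*𝒜)`
(six clauses along `𝟙`), then an isomorphism `x₁^*𝒯 ≅ x₂^*𝒯` of tuples (the letter `tupleIsoAt x₁ x₂ 𝒯 …` UNFOLDED) yields an isomorphism
`(x₁ ≫ ℓ)^*𝒜 ≅ (x₂ ≫ ℓ)^*𝒜` (`tupleIsoAt (x₁ ≫ ℓ) (x₂ ≫ ℓ) 𝒜 …` UNFOLDED): invert the reading at `x₁` (★ `exists_tupleRel_id_symm`, `Spec Ω` reduced,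
connected, Noetherian; Poincaré sheaves normalised by ★ `Polarization.nonempty_unitHatSlice_iso`), compose (★ `tupleRel_comp_id_id`), rebase (★ (R1)).
[cite: MumfordFogartyKirwan1994, Ch. 7 §2 Definition 7.2 (p. 129)] [cite: GortzWedhorn2020, Section (4.7) (pp. 107–108)] -/
theorem exists_tupleIso_comp_of_pointwise {Ω : Type u} [Field Ω] (x₁ x₂ : Spec (CommRingCat.of Ω) ⟶ Z)
    (R₁ : (∃ (G : (𝒯.baseChange x₁).X.left ⟶ ((𝒜.baseChange ℓ).baseChange x₁).X.left) (Ĝ : (DT.baseChange x₁).hat.X.left ⟶ ((D.baseChange ℓ).baseChange x₁).hat.X.left),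
        (lvlT.baseChange x₁).IsBaseChangeVia ((lvl.baseChange ℓ).baseChange x₁) (𝟙 (Spec (CommRingCat.of Ω))) G ∧
        (DT.baseChange x₁).hat.IsBaseChangeVia ((D.baseChange ℓ).baseChange x₁).hat (𝟙 (Spec (CommRingCat.of Ω))) Ĝ ∧
        (∃ (wG : (𝒯.baseChange x₁).X.hom ≫ 𝟙 (Spec (CommRingCat.of Ω)) = G ≫ ((𝒜.baseChange ℓ).baseChange x₁).X.hom)
            (wĜ : (DT.baseChange x₁).hat.X.hom ≫ 𝟙 (Spec (CommRingCat.of Ω)) = Ĝ ≫ ((D.baseChange ℓ).baseChange x₁).hat.X.hom),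
          Nonempty ((Scheme.Modules.pullback
            (pullback.map (𝒯.baseChange x₁).X.hom (DT.baseChange x₁).hat.X.hom ((𝒜.baseChange ℓ).baseChange x₁).X.hom ((D.baseChange ℓ).baseChange x₁).hat.X.hom
              G Ĝ (𝟙 (Spec (CommRingCat.of Ω))) wG wĜ)).obj ((D.baseChange ℓ).baseChange x₁).P ≅ (DT.baseChange x₁).P)) ∧
        (polT.baseChange x₁).lam.left ≫ Ĝ = G ≫ ((pol.baseChange ℓ).baseChange x₁).lam.left ∧
        ∀ a : O, (baseChangeHom (ρT.i a) x₁).left ≫ G = G ≫ (baseChangeHom ((ρ.baseChange ℓ).i a) x₁).left))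
    (R₂ : (∃ (G : (𝒯.baseChange x₂).X.left ⟶ ((𝒜.baseChange ℓ).baseChange x₂).X.left) (Ĝ : (DT.baseChange x₂).hat.X.left ⟶ ((D.baseChange ℓ).baseChange x₂).hat.X.left),
        (lvlT.baseChange x₂).IsBaseChangeVia ((lvl.baseChange ℓ).baseChange x₂) (𝟙 (Spec (CommRingCat.of Ω))) G ∧
        (DT.baseChange x₂).hat.IsBaseChangeVia ((D.baseChange ℓ).baseChange x₂).hat (𝟙 (Spec (CommRingCat.of Ω))) Ĝ ∧
        (∃ (wG : (𝒯.baseChange x₂).X.hom ≫ 𝟙 (Spec (CommRingCat.of Ω)) = G ≫ ((𝒜.baseChange ℓ).baseChange x₂).X.hom)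
            (wĜ : (DT.baseChange x₂).hat.X.hom ≫ 𝟙 (Spec (CommRingCat.of Ω)) = Ĝ ≫ ((D.baseChange ℓ).baseChange x₂).hat.X.hom),
          Nonempty ((Scheme.Modules.pullback
            (pullback.map (𝒯.baseChange x₂).X.hom (DT.baseChange x₂).hat.X.hom ((𝒜.baseChange ℓ).baseChange x₂).X.hom ((D.baseChange ℓ).baseChange x₂).hat.X.hom
              G Ĝ (𝟙 (Spec (CommRingCat.of Ω))) wG wĜ)).obj ((D.baseChange ℓ).baseChange x₂).P ≅ (DT.baseChange x₂).P)) ∧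
        (polT.baseChange x₂).lam.left ≫ Ĝ = G ≫ ((pol.baseChange ℓ).baseChange x₂).lam.left ∧
        ∀ a : O, (baseChangeHom (ρT.i a) x₂).left ≫ G = G ≫ (baseChangeHom ((ρ.baseChange ℓ).i a) x₂).left))
    (h : (∃ (G : (𝒯.baseChange x₁).X.left ⟶ (𝒯.baseChange x₂).X.left) (Ĝ : (DT.baseChange x₁).hat.X.left ⟶ (DT.baseChange x₂).hat.X.left),
        (lvlT.baseChange x₁).IsBaseChangeVia (lvlT.baseChange x₂) (𝟙 (Spec (CommRingCat.of Ω))) G ∧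
        (DT.baseChange x₁).hat.IsBaseChangeVia (DT.baseChange x₂).hat (𝟙 (Spec (CommRingCat.of Ω))) Ĝ ∧
        (∃ (wG : (𝒯.baseChange x₁).X.hom ≫ 𝟙 (Spec (CommRingCat.of Ω)) = G ≫ (𝒯.baseChange x₂).X.hom)
            (wĜ : (DT.baseChange x₁).hat.X.hom ≫ 𝟙 (Spec (CommRingCat.of Ω)) = Ĝ ≫ (DT.baseChange x₂).hat.X.hom),
          Nonempty ((Scheme.Modules.pullback
            (pullback.map (𝒯.baseChange x₁).X.hom (DT.baseChange x₁).hat.X.hom (𝒯.baseChange x₂).X.hom (DT.baseChange x₂).hat.X.hom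
              G Ĝ (𝟙 (Spec (CommRingCat.of Ω))) wG wĜ)).obj (DT.baseChange x₂).P ≅ (DT.baseChange x₁).P)) ∧
        (polT.baseChange x₁).lam.left ≫ Ĝ = G ≫ (polT.baseChange x₂).lam.left ∧
        ∀ a : O, (baseChangeHom (ρT.i a) x₁).left ≫ G = G ≫ (baseChangeHom (ρT.i a) x₂).left)) :
    (∃ (G : (𝒜.baseChange (x₁ ≫ ℓ)).X.left ⟶ (𝒜.baseChange (x₂ ≫ ℓ)).X.left) (Ĝ : (D.baseChange (x₁ ≫ ℓ)).hat.X.left ⟶ (D.baseChange (x₂ ≫ ℓ)).hat.X.left),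
      (lvl.baseChange (x₁ ≫ ℓ)).IsBaseChangeVia (lvl.baseChange (x₂ ≫ ℓ)) (𝟙 (Spec (CommRingCat.of Ω))) G ∧
      (D.baseChange (x₁ ≫ ℓ)).hat.IsBaseChangeVia (D.baseChange (x₂ ≫ ℓ)).hat (𝟙 (Spec (CommRingCat.of Ω))) Ĝ ∧
      (∃ (wG : (𝒜.baseChange (x₁ ≫ ℓ)).X.hom ≫ 𝟙 (Spec (CommRingCat.of Ω)) = G ≫ (𝒜.baseChange (x₂ ≫ ℓ)).X.hom)
          (wĜ : (D.baseChange (x₁ ≫ ℓ)).hat.X.hom ≫ 𝟙 (Spec (CommRingCat.of Ω)) = Ĝ ≫ (D.baseChange (x₂ ≫ ℓ)).hat.X.hom),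
        Nonempty ((Scheme.Modules.pullback
          (pullback.map (𝒜.baseChange (x₁ ≫ ℓ)).X.hom (D.baseChange (x₁ ≫ ℓ)).hat.X.hom (𝒜.baseChange (x₂ ≫ ℓ)).X.hom (D.baseChange (x₂ ≫ ℓ)).hat.X.hom
            G Ĝ (𝟙 (Spec (CommRingCat.of Ω))) wG wĜ)).obj (D.baseChange (x₂ ≫ ℓ)).P ≅ (D.baseChange (x₁ ≫ ℓ)).P)) ∧
      (pol.baseChange (x₁ ≫ ℓ)).lam.left ≫ Ĝ = G ≫ (pol.baseChange (x₂ ≫ ℓ)).lam.left ∧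
      ∀ a : O, (baseChangeHom (ρ.i a) (x₁ ≫ ℓ)).left ≫ G = G ≫ (baseChangeHom (ρ.i a) (x₂ ≫ ℓ)).left) := by
  obtain ⟨G₁, Ĝ₁, r₁⟩ := R₁
  obtain ⟨G₂, Ĝ₂, r₂⟩ := R₂
  obtain ⟨G, Ĝ, hh⟩ := h
  haveI : PreconnectedSpace ↥(Spec (CommRingCat.of Ω)) :=
    ⟨(PreirreducibleSpace.isPreirreducible_univ (X := ↥(Spec (CommRingCat.of Ω)))).isPreconnected⟩
  haveI := (polT.baseChange x₁).isMonHom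
  obtain ⟨G₁', Ĝ₁', r₁'⟩ := exists_tupleRel_id_symm (DT.baseChange x₁) ((D.baseChange ℓ).baseChange x₁) (polT.baseChange x₁).lam
    ((pol.baseChange ℓ).baseChange x₁).lam (polT.baseChange x₁).nonempty_unitHatSlice_iso ((pol.baseChange ℓ).baseChange x₁).nonempty_unitHatSlice_iso
    (lvlT.baseChange x₁) ((lvl.baseChange ℓ).baseChange x₁) (fun a => baseChangeHom (ρT.i a) x₁)
    (fun a => baseChangeHom ((ρ.baseChange ℓ).i a) x₁) r₁
  -- `x₁^*ℓ^*𝒜 → x₁^*𝒯 → x₂^*𝒯 → x₂^*ℓ^*𝒜`, then single presentation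
  exact (exists_tupleIso_baseChange_iff_comp 𝒜 ρ D pol lvl ℓ x₁ x₂).mp
    ⟨_, _, tupleRel_comp_id_id (tupleRel_comp_id_id r₁' hh) r₂⟩

/-- **INJECTIVITY OVER A BASE POINT DESCENDS ALONG A POINTWISE READING.**  `q : Y → S₀`, `s₀ : S₀`; `ℓ : Z → Y` injective on geometric points; `𝒯` over `Z`
read pointwise by `ℓ^*𝒜` at every geometric point.  If «two geometric points of `Y` with the same structure map, centred over `s₀`, with isomorphic `𝒜`-tuples
are EQUAL», then the same holds for `𝒯` over `ℓ ≫ q` (both injectivity clauses UNFOLDED, the tokens of ★ (GS-3)).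
[cite: MumfordFogartyKirwan1994, Ch. 7 §2 Prop. 7.3 (p. 132); §3 Thm. 7.9 (pp. 139–140)] [cite: RapoportSmithlingZhang2020Diagonal, §4.1 Thm. 4.1 p. 17] -/
theorem forall_eq_of_tupleIso_of_pointwise {S₀ : Scheme.{u}} (q : Y ⟶ S₀)
    (hℓ : ∀ ⦃Ω : Type u⦄ [Field Ω] [IsAlgClosed Ω] (x₁ x₂ : Spec (CommRingCat.of Ω) ⟶ Z), x₁ ≫ ℓ = x₂ ≫ ℓ → x₁ = x₂)
    (R : ∀ ⦃Ω : Type u⦄ [Field Ω] [IsAlgClosed Ω] (x : Spec (CommRingCat.of Ω) ⟶ Z),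
      (∃ (G : (𝒯.baseChange x).X.left ⟶ ((𝒜.baseChange ℓ).baseChange x).X.left) (Ĝ : (DT.baseChange x).hat.X.left ⟶ ((D.baseChange ℓ).baseChange x).hat.X.left),
        (lvlT.baseChange x).IsBaseChangeVia ((lvl.baseChange ℓ).baseChange x) (𝟙 (Spec (CommRingCat.of Ω))) G ∧
        (DT.baseChange x).hat.IsBaseChangeVia ((D.baseChange ℓ).baseChange x).hat (𝟙 (Spec (CommRingCat.of Ω))) Ĝ ∧
        (∃ (wG : (𝒯.baseChange x).X.hom ≫ 𝟙 (Spec (CommRingCat.of Ω)) = G ≫ ((𝒜.baseChange ℓ).baseChange x).X.hom)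
            (wĜ : (DT.baseChange x).hat.X.hom ≫ 𝟙 (Spec (CommRingCat.of Ω)) = Ĝ ≫ ((D.baseChange ℓ).baseChange x).hat.X.hom),
          Nonempty ((Scheme.Modules.pullback
            (pullback.map (𝒯.baseChange x).X.hom (DT.baseChange x).hat.X.hom ((𝒜.baseChange ℓ).baseChange x).X.hom ((D.baseChange ℓ).baseChange x).hat.X.hom
              G Ĝ (𝟙 (Spec (CommRingCat.of Ω))) wG wĜ)).obj ((D.baseChange ℓ).baseChange x).P ≅ (DT.baseChange x).P)) ∧
        (polT.baseChange x).lam.left ≫ Ĝ = G ≫ ((pol.baseChange ℓ).baseChange x).lam.left ∧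
        ∀ a : O, (baseChangeHom (ρT.i a) x).left ≫ G = G ≫ (baseChangeHom ((ρ.baseChange ℓ).i a) x).left))
    (s₀ : S₀)
    (h : ∀ ⦃Ω : Type u⦄ [Field Ω] [IsAlgClosed Ω] (y₁ y₂ : Spec (CommRingCat.of Ω) ⟶ Y),
      y₁ ≫ q = y₂ ≫ q → (y₁ ≫ q).base (IsLocalRing.closedPoint Ω) = s₀ →
      (∃ (G : (𝒜.baseChange y₁).X.left ⟶ (𝒜.baseChange y₂).X.left) (Ĝ : (D.baseChange y₁).hat.X.left ⟶ (D.baseChange y₂).hat.X.left),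
        (lvl.baseChange y₁).IsBaseChangeVia (lvl.baseChange y₂) (𝟙 (Spec (CommRingCat.of Ω))) G ∧
        (D.baseChange y₁).hat.IsBaseChangeVia (D.baseChange y₂).hat (𝟙 (Spec (CommRingCat.of Ω))) Ĝ ∧
        (∃ (wG : (𝒜.baseChange y₁).X.hom ≫ 𝟙 (Spec (CommRingCat.of Ω)) = G ≫ (𝒜.baseChange y₂).X.hom)
            (wĜ : (D.baseChange y₁).hat.X.hom ≫ 𝟙 (Spec (CommRingCat.of Ω)) = Ĝ ≫ (D.baseChange y₂).hat.X.hom),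
          Nonempty ((Scheme.Modules.pullback
            (pullback.map (𝒜.baseChange y₁).X.hom (D.baseChange y₁).hat.X.hom (𝒜.baseChange y₂).X.hom (D.baseChange y₂).hat.X.hom
              G Ĝ (𝟙 (Spec (CommRingCat.of Ω))) wG wĜ)).obj (D.baseChange y₂).P ≅ (D.baseChange y₁).P)) ∧
        (pol.baseChange y₁).lam.left ≫ Ĝ = G ≫ (pol.baseChange y₂).lam.left ∧
        ∀ a : O, (baseChangeHom (ρ.i a) y₁).left ≫ G = G ≫ (baseChangeHom (ρ.i a) y₂).left) → y₁ = y₂) :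
    ∀ ⦃Ω : Type u⦄ [Field Ω] [IsAlgClosed Ω] (x₁ x₂ : Spec (CommRingCat.of Ω) ⟶ Z),
      x₁ ≫ ℓ ≫ q = x₂ ≫ ℓ ≫ q → (x₁ ≫ ℓ ≫ q).base (IsLocalRing.closedPoint Ω) = s₀ →
      (∃ (G : (𝒯.baseChange x₁).X.left ⟶ (𝒯.baseChange x₂).X.left) (Ĝ : (DT.baseChange x₁).hat.X.left ⟶ (DT.baseChange x₂).hat.X.left),
        (lvlT.baseChange x₁).IsBaseChangeVia (lvlT.baseChange x₂) (𝟙 (Spec (CommRingCat.of Ω))) G ∧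
        (DT.baseChange x₁).hat.IsBaseChangeVia (DT.baseChange x₂).hat (𝟙 (Spec (CommRingCat.of Ω))) Ĝ ∧
        (∃ (wG : (𝒯.baseChange x₁).X.hom ≫ 𝟙 (Spec (CommRingCat.of Ω)) = G ≫ (𝒯.baseChange x₂).X.hom)
            (wĜ : (DT.baseChange x₁).hat.X.hom ≫ 𝟙 (Spec (CommRingCat.of Ω)) = Ĝ ≫ (DT.baseChange x₂).hat.X.hom),
          Nonempty ((Scheme.Modules.pullback
            (pullback.map (𝒯.baseChange x₁).X.hom (DT.baseChange x₁).hat.X.hom (𝒯.baseChange x₂).X.hom (DT.baseChange x₂).hat.X.hom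
              G Ĝ (𝟙 (Spec (CommRingCat.of Ω))) wG wĜ)).obj (DT.baseChange x₂).P ≅ (DT.baseChange x₁).P)) ∧
        (polT.baseChange x₁).lam.left ≫ Ĝ = G ≫ (polT.baseChange x₂).lam.left ∧
        ∀ a : O, (baseChangeHom (ρT.i a) x₁).left ≫ G = G ≫ (baseChangeHom (ρT.i a) x₂).left) → x₁ = x₂ := by
  intro Ω _ _ x₁ x₂ hq hs hiso
  apply hℓ
  apply h (x₁ ≫ ℓ) (x₂ ≫ ℓ) (by simpa only [Category.assoc] using hq) (by simpa only [Category.assoc] using hs)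
  exact exists_tupleIso_comp_of_pointwise ℓ 𝒜 ρ D pol lvl 𝒯 ρT DT polT lvlT x₁ x₂ (R x₁) (R x₂) hiso

end Transport

section Head

variable {B : Type u} [CommRing B] [IsDedekindDomain B] {Y : Scheme.{u}} (q : Y ⟶ Spec (CommRingCat.of B))
  [QuasiCompact q] [LocallyOfFiniteType q] [IsSeparated q]
  (𝒜 : AbelianSchemeOver Y) {O : Type*} [CommRing O] (ρ : RingAction O 𝒜) (D : 𝒜.DualPair) (pol : 𝒜.Polarization D)
  {g N : ℕ} (lvl : 𝒜.LevelStructure g N)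

/-- **HEAD — SPECIAL INJECTIVITY OFF A FINITE SET OF PRIMES FOR EVERY TUPLE READ POINTWISE BY THE GLOBAL FAMILY.**  ★ (GS-3)
`exists_finset_forall_eq_of_tupleIsoAt` for ONE tuple `𝒜` over `q : Y → Spec B` (its hypotheses `hpieces`, `hgen` VERBATIM) yields a finite `S` of height-one
primes that serves EVERY `ℓ : Z → Y` injective on geometric points and EVERY tuple `𝒯` over `Z` read pointwise by `ℓ^*𝒜`: for `v ∉ S`, two geometric points of
`Z` with the same structure map `ℓ ≫ q`, centred over `v`, with isomorphic `𝒯`-tuples, are EQUAL (the `inj₀` law of a LOCAL SPREAD read pointwise by the STAGE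
family — memo §1, no rigidity transfer). [cite: MumfordFogartyKirwan1994, Ch. 7 §2 Prop. 7.3 (p. 132); §3 Thm. 7.9 (pp. 139–140)]
[cite: EGAIV3, (9.2.1)–(9.2.3)] [cite: RapoportSmithlingZhang2020Diagonal, §4.1 Thm. 4.1 p. 17] -/
theorem exists_finset_forall_eq_of_tupleIsoAt_of_pointwise
    (hpieces : ∃ (r : ℕ) (I : Fin r → Scheme.{u}) (f : ∀ i, I i ⟶ pullback q q) (_ : ∀ i, QuasiCompact (f i))
      (_ : ∀ i, LocallyOfFiniteType (f i)),
      ∀ ⦃Ω : Type u⦄ [Field Ω] [IsAlgClosed Ω] (t : Spec (CommRingCat.of Ω) ⟶ pullback q q),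
        (∃ (G : ((𝒜.baseChange (pullback.fst q q)).baseChange t).X.left ⟶ ((𝒜.baseChange (pullback.snd q q)).baseChange t).X.left)
            (Ĝ : ((D.baseChange (pullback.fst q q)).baseChange t).hat.X.left ⟶ ((D.baseChange (pullback.snd q q)).baseChange t).hat.X.left),
          ((lvl.baseChange (pullback.fst q q)).baseChange t).IsBaseChangeVia ((lvl.baseChange (pullback.snd q q)).baseChange t)
              (𝟙 (Spec (CommRingCat.of Ω))) G ∧
          ((D.baseChange (pullback.fst q q)).baseChange t).hat.IsBaseChangeVia ((D.baseChange (pullback.snd q q)).baseChange t).hat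
              (𝟙 (Spec (CommRingCat.of Ω))) Ĝ ∧
          (∃ (wG : ((𝒜.baseChange (pullback.fst q q)).baseChange t).X.hom ≫ 𝟙 (Spec (CommRingCat.of Ω)) =
                G ≫ ((𝒜.baseChange (pullback.snd q q)).baseChange t).X.hom)
              (wĜ : ((D.baseChange (pullback.fst q q)).baseChange t).hat.X.hom ≫ 𝟙 (Spec (CommRingCat.of Ω)) =
                Ĝ ≫ ((D.baseChange (pullback.snd q q)).baseChange t).hat.X.hom),
            Nonempty ((Scheme.Modules.pullback
              (pullback.map ((𝒜.baseChange (pullback.fst q q)).baseChange t).X.hom ((D.baseChange (pullback.fst q q)).baseChange t).hat.X.hom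
                ((𝒜.baseChange (pullback.snd q q)).baseChange t).X.hom ((D.baseChange (pullback.snd q q)).baseChange t).hat.X.hom
                G Ĝ (𝟙 (Spec (CommRingCat.of Ω))) wG wĜ)).obj ((D.baseChange (pullback.snd q q)).baseChange t).P ≅
              ((D.baseChange (pullback.fst q q)).baseChange t).P)) ∧
          ((pol.baseChange (pullback.fst q q)).baseChange t).lam.left ≫ Ĝ = G ≫ ((pol.baseChange (pullback.snd q q)).baseChange t).lam.left ∧
          ∀ a : O, (baseChangeHom ((ρ.baseChange (pullback.fst q q)).i a) t).left ≫ G =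
            G ≫ (baseChangeHom ((ρ.baseChange (pullback.snd q q)).i a) t).left) ↔
        ∃ (i : Fin r) (s : Spec (CommRingCat.of Ω) ⟶ I i), s ≫ f i = t)
    (hgen : ∀ ⦃Ω : Type u⦄ [Field Ω] [IsAlgClosed Ω] (y₁ y₂ : Spec (CommRingCat.of Ω) ⟶ Y),
      y₁ ≫ q = y₂ ≫ q → (y₁ ≫ q).base (IsLocalRing.closedPoint Ω) = (⊥ : PrimeSpectrum B) →
      (∃ (G : (𝒜.baseChange y₁).X.left ⟶ (𝒜.baseChange y₂).X.left) (Ĝ : (D.baseChange y₁).hat.X.left ⟶ (D.baseChange y₂).hat.X.left),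
        (lvl.baseChange y₁).IsBaseChangeVia (lvl.baseChange y₂) (𝟙 (Spec (CommRingCat.of Ω))) G ∧
        (D.baseChange y₁).hat.IsBaseChangeVia (D.baseChange y₂).hat (𝟙 (Spec (CommRingCat.of Ω))) Ĝ ∧
        (∃ (wG : (𝒜.baseChange y₁).X.hom ≫ 𝟙 (Spec (CommRingCat.of Ω)) = G ≫ (𝒜.baseChange y₂).X.hom)
            (wĜ : (D.baseChange y₁).hat.X.hom ≫ 𝟙 (Spec (CommRingCat.of Ω)) = Ĝ ≫ (D.baseChange y₂).hat.X.hom),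
          Nonempty ((Scheme.Modules.pullback
            (pullback.map (𝒜.baseChange y₁).X.hom (D.baseChange y₁).hat.X.hom (𝒜.baseChange y₂).X.hom (D.baseChange y₂).hat.X.hom
              G Ĝ (𝟙 (Spec (CommRingCat.of Ω))) wG wĜ)).obj (D.baseChange y₂).P ≅ (D.baseChange y₁).P)) ∧
        (pol.baseChange y₁).lam.left ≫ Ĝ = G ≫ (pol.baseChange y₂).lam.left ∧
        ∀ a : O, (baseChangeHom (ρ.i a) y₁).left ≫ G = G ≫ (baseChangeHom (ρ.i a) y₂).left) → y₁ = y₂)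
    {Z : Scheme.{u}} (ℓ : Z ⟶ Y)
    (hℓ : ∀ ⦃Ω : Type u⦄ [Field Ω] [IsAlgClosed Ω] (x₁ x₂ : Spec (CommRingCat.of Ω) ⟶ Z), x₁ ≫ ℓ = x₂ ≫ ℓ → x₁ = x₂)
    (𝒯 : AbelianSchemeOver Z) (ρT : RingAction O 𝒯) (DT : 𝒯.DualPair) (polT : 𝒯.Polarization DT) (lvlT : 𝒯.LevelStructure g N)
    (R : ∀ ⦃Ω : Type u⦄ [Field Ω] [IsAlgClosed Ω] (x : Spec (CommRingCat.of Ω) ⟶ Z),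
      (∃ (G : (𝒯.baseChange x).X.left ⟶ ((𝒜.baseChange ℓ).baseChange x).X.left) (Ĝ : (DT.baseChange x).hat.X.left ⟶ ((D.baseChange ℓ).baseChange x).hat.X.left),
        (lvlT.baseChange x).IsBaseChangeVia ((lvl.baseChange ℓ).baseChange x) (𝟙 (Spec (CommRingCat.of Ω))) G ∧
        (DT.baseChange x).hat.IsBaseChangeVia ((D.baseChange ℓ).baseChange x).hat (𝟙 (Spec (CommRingCat.of Ω))) Ĝ ∧
        (∃ (wG : (𝒯.baseChange x).X.hom ≫ 𝟙 (Spec (CommRingCat.of Ω)) = G ≫ ((𝒜.baseChange ℓ).baseChange x).X.hom)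
            (wĜ : (DT.baseChange x).hat.X.hom ≫ 𝟙 (Spec (CommRingCat.of Ω)) = Ĝ ≫ ((D.baseChange ℓ).baseChange x).hat.X.hom),
          Nonempty ((Scheme.Modules.pullback
            (pullback.map (𝒯.baseChange x).X.hom (DT.baseChange x).hat.X.hom ((𝒜.baseChange ℓ).baseChange x).X.hom ((D.baseChange ℓ).baseChange x).hat.X.hom
              G Ĝ (𝟙 (Spec (CommRingCat.of Ω))) wG wĜ)).obj ((D.baseChange ℓ).baseChange x).P ≅ (DT.baseChange x).P)) ∧
        (polT.baseChange x).lam.left ≫ Ĝ = G ≫ ((pol.baseChange ℓ).baseChange x).lam.left ∧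
        ∀ a : O, (baseChangeHom (ρT.i a) x).left ≫ G = G ≫ (baseChangeHom ((ρ.baseChange ℓ).i a) x).left)) :
    ∃ S : Finset (IsDedekindDomain.HeightOneSpectrum B),
      ∀ (v : IsDedekindDomain.HeightOneSpectrum B), v ∉ S →
        ∀ ⦃Ω : Type u⦄ [Field Ω] [IsAlgClosed Ω] (x₁ x₂ : Spec (CommRingCat.of Ω) ⟶ Z),
          x₁ ≫ ℓ ≫ q = x₂ ≫ ℓ ≫ q → (x₁ ≫ ℓ ≫ q).base (IsLocalRing.closedPoint Ω) = ⟨v.asIdeal, v.isPrime⟩ →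
          (∃ (G : (𝒯.baseChange x₁).X.left ⟶ (𝒯.baseChange x₂).X.left) (Ĝ : (DT.baseChange x₁).hat.X.left ⟶ (DT.baseChange x₂).hat.X.left),
            (lvlT.baseChange x₁).IsBaseChangeVia (lvlT.baseChange x₂) (𝟙 (Spec (CommRingCat.of Ω))) G ∧
            (DT.baseChange x₁).hat.IsBaseChangeVia (DT.baseChange x₂).hat (𝟙 (Spec (CommRingCat.of Ω))) Ĝ ∧
            (∃ (wG : (𝒯.baseChange x₁).X.hom ≫ 𝟙 (Spec (CommRingCat.of Ω)) = G ≫ (𝒯.baseChange x₂).X.hom)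
                (wĜ : (DT.baseChange x₁).hat.X.hom ≫ 𝟙 (Spec (CommRingCat.of Ω)) = Ĝ ≫ (DT.baseChange x₂).hat.X.hom),
              Nonempty ((Scheme.Modules.pullback
                (pullback.map (𝒯.baseChange x₁).X.hom (DT.baseChange x₁).hat.X.hom (𝒯.baseChange x₂).X.hom (DT.baseChange x₂).hat.X.hom
                  G Ĝ (𝟙 (Spec (CommRingCat.of Ω))) wG wĜ)).obj (DT.baseChange x₂).P ≅ (DT.baseChange x₁).P)) ∧
            (polT.baseChange x₁).lam.left ≫ Ĝ = G ≫ (polT.baseChange x₂).lam.left ∧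
            ∀ a : O, (baseChangeHom (ρT.i a) x₁).left ≫ G = G ≫ (baseChangeHom (ρT.i a) x₂).left) → x₁ = x₂ := by
  obtain ⟨S, hS⟩ := exists_finset_forall_eq_of_tupleIsoAt q 𝒜 ρ D pol lvl hpieces hgen
  exact ⟨S, fun v hv => forall_eq_of_tupleIso_of_pointwise ℓ 𝒜 ρ D pol lvl 𝒯 ρT DT polT lvlT q hℓ R _ (hS v hv)⟩

end Head

/-! ### ED. 2 — the CONVERSE transport (for the GENERIC INJECTIVITY input `hgen₀` of ★ (GS-3c′)) -/

section TransportConverse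

variable {Y Z : Scheme.{u}} (ℓ : Z ⟶ Y) {O : Type*} [CommRing O]
  (𝒜 : AbelianSchemeOver Y) (ρ : RingAction O 𝒜) (D : 𝒜.DualPair) (pol : 𝒜.Polarization D) {g N : ℕ} (lvl : 𝒜.LevelStructure g N)
  (𝒯 : AbelianSchemeOver Z) (ρT : RingAction O 𝒯) (DT : 𝒯.DualPair) (polT : 𝒯.Polarization DT) (lvlT : 𝒯.LevelStructure g N)

/-- **ONE-PAIR TRANSPORT, CONVERSE DIRECTION.**  With the pointwise readings `xᵢ^*𝒯 ≅ xᵢ^*ℓ^*𝒜` at two field points, an isomorphism of tuples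
`(x₁ ≫ ℓ)^*𝒜 ≅ (x₂ ≫ ℓ)^*𝒜` (`tupleIsoAt (x₁ ≫ ℓ) (x₂ ≫ ℓ) 𝒜 …` UNFOLDED) yields `x₁^*𝒯 ≅ x₂^*𝒯` (`tupleIsoAt x₁ x₂ 𝒯 …` UNFOLDED): rebase (★ (R1)),
precompose the reading at `x₁`, postcompose the INVERSE of the reading at `x₂` (★ `exists_tupleRel_id_symm`), compose (★ `tupleRel_comp_id_id`).
[cite: MumfordFogartyKirwan1994, Ch. 7 §2 Definition 7.2 (p. 129)] [cite: GortzWedhorn2020, Section (4.7) (pp. 107–108)] -/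
theorem exists_tupleIso_of_comp_of_pointwise {Ω : Type u} [Field Ω] (x₁ x₂ : Spec (CommRingCat.of Ω) ⟶ Z)
    (R₁ : (∃ (G : (𝒯.baseChange x₁).X.left ⟶ ((𝒜.baseChange ℓ).baseChange x₁).X.left) (Ĝ : (DT.baseChange x₁).hat.X.left ⟶ ((D.baseChange ℓ).baseChange x₁).hat.X.left),
        (lvlT.baseChange x₁).IsBaseChangeVia ((lvl.baseChange ℓ).baseChange x₁) (𝟙 (Spec (CommRingCat.of Ω))) G ∧
        (DT.baseChange x₁).hat.IsBaseChangeVia ((D.baseChange ℓ).baseChange x₁).hat (𝟙 (Spec (CommRingCat.of Ω))) Ĝ ∧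
        (∃ (wG : (𝒯.baseChange x₁).X.hom ≫ 𝟙 (Spec (CommRingCat.of Ω)) = G ≫ ((𝒜.baseChange ℓ).baseChange x₁).X.hom)
            (wĜ : (DT.baseChange x₁).hat.X.hom ≫ 𝟙 (Spec (CommRingCat.of Ω)) = Ĝ ≫ ((D.baseChange ℓ).baseChange x₁).hat.X.hom),
          Nonempty ((Scheme.Modules.pullback
            (pullback.map (𝒯.baseChange x₁).X.hom (DT.baseChange x₁).hat.X.hom ((𝒜.baseChange ℓ).baseChange x₁).X.hom ((D.baseChange ℓ).baseChange x₁).hat.X.hom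
              G Ĝ (𝟙 (Spec (CommRingCat.of Ω))) wG wĜ)).obj ((D.baseChange ℓ).baseChange x₁).P ≅ (DT.baseChange x₁).P)) ∧
        (polT.baseChange x₁).lam.left ≫ Ĝ = G ≫ ((pol.baseChange ℓ).baseChange x₁).lam.left ∧
        ∀ a : O, (baseChangeHom (ρT.i a) x₁).left ≫ G = G ≫ (baseChangeHom ((ρ.baseChange ℓ).i a) x₁).left))
    (R₂ : (∃ (G : (𝒯.baseChange x₂).X.left ⟶ ((𝒜.baseChange ℓ).baseChange x₂).X.left) (Ĝ : (DT.baseChange x₂).hat.X.left ⟶ ((D.baseChange ℓ).baseChange x₂).hat.X.left),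
        (lvlT.baseChange x₂).IsBaseChangeVia ((lvl.baseChange ℓ).baseChange x₂) (𝟙 (Spec (CommRingCat.of Ω))) G ∧
        (DT.baseChange x₂).hat.IsBaseChangeVia ((D.baseChange ℓ).baseChange x₂).hat (𝟙 (Spec (CommRingCat.of Ω))) Ĝ ∧
        (∃ (wG : (𝒯.baseChange x₂).X.hom ≫ 𝟙 (Spec (CommRingCat.of Ω)) = G ≫ ((𝒜.baseChange ℓ).baseChange x₂).X.hom)
            (wĜ : (DT.baseChange x₂).hat.X.hom ≫ 𝟙 (Spec (CommRingCat.of Ω)) = Ĝ ≫ ((D.baseChange ℓ).baseChange x₂).hat.X.hom),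
          Nonempty ((Scheme.Modules.pullback
            (pullback.map (𝒯.baseChange x₂).X.hom (DT.baseChange x₂).hat.X.hom ((𝒜.baseChange ℓ).baseChange x₂).X.hom ((D.baseChange ℓ).baseChange x₂).hat.X.hom
              G Ĝ (𝟙 (Spec (CommRingCat.of Ω))) wG wĜ)).obj ((D.baseChange ℓ).baseChange x₂).P ≅ (DT.baseChange x₂).P)) ∧
        (polT.baseChange x₂).lam.left ≫ Ĝ = G ≫ ((pol.baseChange ℓ).baseChange x₂).lam.left ∧
        ∀ a : O, (baseChangeHom (ρT.i a) x₂).left ≫ G = G ≫ (baseChangeHom ((ρ.baseChange ℓ).i a) x₂).left))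
    (h : (∃ (G : (𝒜.baseChange (x₁ ≫ ℓ)).X.left ⟶ (𝒜.baseChange (x₂ ≫ ℓ)).X.left) (Ĝ : (D.baseChange (x₁ ≫ ℓ)).hat.X.left ⟶ (D.baseChange (x₂ ≫ ℓ)).hat.X.left),
        (lvl.baseChange (x₁ ≫ ℓ)).IsBaseChangeVia (lvl.baseChange (x₂ ≫ ℓ)) (𝟙 (Spec (CommRingCat.of Ω))) G ∧
        (D.baseChange (x₁ ≫ ℓ)).hat.IsBaseChangeVia (D.baseChange (x₂ ≫ ℓ)).hat (𝟙 (Spec (CommRingCat.of Ω))) Ĝ ∧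
        (∃ (wG : (𝒜.baseChange (x₁ ≫ ℓ)).X.hom ≫ 𝟙 (Spec (CommRingCat.of Ω)) = G ≫ (𝒜.baseChange (x₂ ≫ ℓ)).X.hom)
            (wĜ : (D.baseChange (x₁ ≫ ℓ)).hat.X.hom ≫ 𝟙 (Spec (CommRingCat.of Ω)) = Ĝ ≫ (D.baseChange (x₂ ≫ ℓ)).hat.X.hom),
          Nonempty ((Scheme.Modules.pullback
            (pullback.map (𝒜.baseChange (x₁ ≫ ℓ)).X.hom (D.baseChange (x₁ ≫ ℓ)).hat.X.hom (𝒜.baseChange (x₂ ≫ ℓ)).X.hom (D.baseChange (x₂ ≫ ℓ)).hat.X.hom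
              G Ĝ (𝟙 (Spec (CommRingCat.of Ω))) wG wĜ)).obj (D.baseChange (x₂ ≫ ℓ)).P ≅ (D.baseChange (x₁ ≫ ℓ)).P)) ∧
        (pol.baseChange (x₁ ≫ ℓ)).lam.left ≫ Ĝ = G ≫ (pol.baseChange (x₂ ≫ ℓ)).lam.left ∧
        ∀ a : O, (baseChangeHom (ρ.i a) (x₁ ≫ ℓ)).left ≫ G = G ≫ (baseChangeHom (ρ.i a) (x₂ ≫ ℓ)).left)) :
    (∃ (G : (𝒯.baseChange x₁).X.left ⟶ (𝒯.baseChange x₂).X.left) (Ĝ : (DT.baseChange x₁).hat.X.left ⟶ (DT.baseChange x₂).hat.X.left),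
      (lvlT.baseChange x₁).IsBaseChangeVia (lvlT.baseChange x₂) (𝟙 (Spec (CommRingCat.of Ω))) G ∧
      (DT.baseChange x₁).hat.IsBaseChangeVia (DT.baseChange x₂).hat (𝟙 (Spec (CommRingCat.of Ω))) Ĝ ∧
      (∃ (wG : (𝒯.baseChange x₁).X.hom ≫ 𝟙 (Spec (CommRingCat.of Ω)) = G ≫ (𝒯.baseChange x₂).X.hom)
          (wĜ : (DT.baseChange x₁).hat.X.hom ≫ 𝟙 (Spec (CommRingCat.of Ω)) = Ĝ ≫ (DT.baseChange x₂).hat.X.hom),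
        Nonempty ((Scheme.Modules.pullback
          (pullback.map (𝒯.baseChange x₁).X.hom (DT.baseChange x₁).hat.X.hom (𝒯.baseChange x₂).X.hom (DT.baseChange x₂).hat.X.hom
            G Ĝ (𝟙 (Spec (CommRingCat.of Ω))) wG wĜ)).obj (DT.baseChange x₂).P ≅ (DT.baseChange x₁).P)) ∧
      (polT.baseChange x₁).lam.left ≫ Ĝ = G ≫ (polT.baseChange x₂).lam.left ∧
      ∀ a : O, (baseChangeHom (ρT.i a) x₁).left ≫ G = G ≫ (baseChangeHom (ρT.i a) x₂).left) := by
  obtain ⟨G₁, Ĝ₁, r₁⟩ := R₁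
  obtain ⟨G₂, Ĝ₂, r₂⟩ := R₂
  obtain ⟨G, Ĝ, hh⟩ := (exists_tupleIso_baseChange_iff_comp 𝒜 ρ D pol lvl ℓ x₁ x₂).mpr h
  haveI : PreconnectedSpace ↥(Spec (CommRingCat.of Ω)) :=
    ⟨(PreirreducibleSpace.isPreirreducible_univ (X := ↥(Spec (CommRingCat.of Ω)))).isPreconnected⟩
  haveI := (polT.baseChange x₂).isMonHom
  obtain ⟨G₂', Ĝ₂', r₂'⟩ := exists_tupleRel_id_symm (DT.baseChange x₂) ((D.baseChange ℓ).baseChange x₂) (polT.baseChange x₂).lam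
    ((pol.baseChange ℓ).baseChange x₂).lam (polT.baseChange x₂).nonempty_unitHatSlice_iso ((pol.baseChange ℓ).baseChange x₂).nonempty_unitHatSlice_iso
    (lvlT.baseChange x₂) ((lvl.baseChange ℓ).baseChange x₂) (fun a => baseChangeHom (ρT.i a) x₂)
    (fun a => baseChangeHom ((ρ.baseChange ℓ).i a) x₂) r₂
  -- `x₁^*𝒯 → x₁^*ℓ^*𝒜 → x₂^*ℓ^*𝒜 → x₂^*𝒯`
  exact ⟨_, _, tupleRel_comp_id_id (tupleRel_comp_id_id r₁ hh) r₂'⟩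

/-- **GENERIC-INJECTIVITY INPUT OF ★ (GS-3c′) FROM THE TUPLE UPSTAIRS.**  `q : Y → S₀`, `s : Spec Ω₀ → S₀` one base point (e.g. `Spec ι₀` at the generic
point); `ℓ : Z → Y` such that every `Ω₀`-point of `Y` over `s` FACTORS through `ℓ` (e.g. `Z` = the generic fibre); `𝒯` over `Z` read pointwise by `ℓ^*𝒜` at
the `Ω₀`-points over `s`.  If «two `Ω₀`-points of `Z` over `s` with isomorphic `𝒯`-tuples are EQUAL» (the E-side separation), then «two `Ω₀`-points of `Y`
over `s` with isomorphic `𝒜`-tuples are EQUAL» — VERBATIM the hypothesis `hgen₀` of ★ `forall_eq_of_tupleIsoAt_generic_of_algClosed` (with `s := Spec.map ι₀`).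
[cite: MumfordFogartyKirwan1994, Ch. 7 §2 Prop. 7.3 (p. 132); §3 Thm. 7.9 (pp. 139–140)] [cite: RapoportSmithlingZhang2020Diagonal, §4.1 Thm. 4.1 p. 17] -/
theorem forall_eq_of_tupleIso_of_pointwise_of_fac {S₀ : Scheme.{u}} (q : Y ⟶ S₀) {Ω : Type u} [Field Ω] (s : Spec (CommRingCat.of Ω) ⟶ S₀)
    (hfac : ∀ y : Spec (CommRingCat.of Ω) ⟶ Y, y ≫ q = s → ∃ x : Spec (CommRingCat.of Ω) ⟶ Z, x ≫ ℓ = y)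
    (R : ∀ x : Spec (CommRingCat.of Ω) ⟶ Z, x ≫ ℓ ≫ q = s →
      (∃ (G : (𝒯.baseChange x).X.left ⟶ ((𝒜.baseChange ℓ).baseChange x).X.left) (Ĝ : (DT.baseChange x).hat.X.left ⟶ ((D.baseChange ℓ).baseChange x).hat.X.left),
        (lvlT.baseChange x).IsBaseChangeVia ((lvl.baseChange ℓ).baseChange x) (𝟙 (Spec (CommRingCat.of Ω))) G ∧
        (DT.baseChange x).hat.IsBaseChangeVia ((D.baseChange ℓ).baseChange x).hat (𝟙 (Spec (CommRingCat.of Ω))) Ĝ ∧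
        (∃ (wG : (𝒯.baseChange x).X.hom ≫ 𝟙 (Spec (CommRingCat.of Ω)) = G ≫ ((𝒜.baseChange ℓ).baseChange x).X.hom)
            (wĜ : (DT.baseChange x).hat.X.hom ≫ 𝟙 (Spec (CommRingCat.of Ω)) = Ĝ ≫ ((D.baseChange ℓ).baseChange x).hat.X.hom),
          Nonempty ((Scheme.Modules.pullback
            (pullback.map (𝒯.baseChange x).X.hom (DT.baseChange x).hat.X.hom ((𝒜.baseChange ℓ).baseChange x).X.hom ((D.baseChange ℓ).baseChange x).hat.X.hom
              G Ĝ (𝟙 (Spec (CommRingCat.of Ω))) wG wĜ)).obj ((D.baseChange ℓ).baseChange x).P ≅ (DT.baseChange x).P)) ∧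
        (polT.baseChange x).lam.left ≫ Ĝ = G ≫ ((pol.baseChange ℓ).baseChange x).lam.left ∧
        ∀ a : O, (baseChangeHom (ρT.i a) x).left ≫ G = G ≫ (baseChangeHom ((ρ.baseChange ℓ).i a) x).left))
    (hT : ∀ x₁ x₂ : Spec (CommRingCat.of Ω) ⟶ Z, x₁ ≫ ℓ ≫ q = s → x₂ ≫ ℓ ≫ q = s →
      (∃ (G : (𝒯.baseChange x₁).X.left ⟶ (𝒯.baseChange x₂).X.left) (Ĝ : (DT.baseChange x₁).hat.X.left ⟶ (DT.baseChange x₂).hat.X.left),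
        (lvlT.baseChange x₁).IsBaseChangeVia (lvlT.baseChange x₂) (𝟙 (Spec (CommRingCat.of Ω))) G ∧
        (DT.baseChange x₁).hat.IsBaseChangeVia (DT.baseChange x₂).hat (𝟙 (Spec (CommRingCat.of Ω))) Ĝ ∧
        (∃ (wG : (𝒯.baseChange x₁).X.hom ≫ 𝟙 (Spec (CommRingCat.of Ω)) = G ≫ (𝒯.baseChange x₂).X.hom)
            (wĜ : (DT.baseChange x₁).hat.X.hom ≫ 𝟙 (Spec (CommRingCat.of Ω)) = Ĝ ≫ (DT.baseChange x₂).hat.X.hom),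
          Nonempty ((Scheme.Modules.pullback
            (pullback.map (𝒯.baseChange x₁).X.hom (DT.baseChange x₁).hat.X.hom (𝒯.baseChange x₂).X.hom (DT.baseChange x₂).hat.X.hom
              G Ĝ (𝟙 (Spec (CommRingCat.of Ω))) wG wĜ)).obj (DT.baseChange x₂).P ≅ (DT.baseChange x₁).P)) ∧
        (polT.baseChange x₁).lam.left ≫ Ĝ = G ≫ (polT.baseChange x₂).lam.left ∧
        ∀ a : O, (baseChangeHom (ρT.i a) x₁).left ≫ G = G ≫ (baseChangeHom (ρT.i a) x₂).left) → x₁ = x₂) :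
    ∀ y₁ y₂ : Spec (CommRingCat.of Ω) ⟶ Y, y₁ ≫ q = s → y₂ ≫ q = s →
      (∃ (G : (𝒜.baseChange y₁).X.left ⟶ (𝒜.baseChange y₂).X.left) (Ĝ : (D.baseChange y₁).hat.X.left ⟶ (D.baseChange y₂).hat.X.left),
        (lvl.baseChange y₁).IsBaseChangeVia (lvl.baseChange y₂) (𝟙 (Spec (CommRingCat.of Ω))) G ∧
        (D.baseChange y₁).hat.IsBaseChangeVia (D.baseChange y₂).hat (𝟙 (Spec (CommRingCat.of Ω))) Ĝ ∧
        (∃ (wG : (𝒜.baseChange y₁).X.hom ≫ 𝟙 (Spec (CommRingCat.of Ω)) = G ≫ (𝒜.baseChange y₂).X.hom)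
            (wĜ : (D.baseChange y₁).hat.X.hom ≫ 𝟙 (Spec (CommRingCat.of Ω)) = Ĝ ≫ (D.baseChange y₂).hat.X.hom),
          Nonempty ((Scheme.Modules.pullback
            (pullback.map (𝒜.baseChange y₁).X.hom (D.baseChange y₁).hat.X.hom (𝒜.baseChange y₂).X.hom (D.baseChange y₂).hat.X.hom
              G Ĝ (𝟙 (Spec (CommRingCat.of Ω))) wG wĜ)).obj (D.baseChange y₂).P ≅ (D.baseChange y₁).P)) ∧
        (pol.baseChange y₁).lam.left ≫ Ĝ = G ≫ (pol.baseChange y₂).lam.left ∧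
        ∀ a : O, (baseChangeHom (ρ.i a) y₁).left ≫ G = G ≫ (baseChangeHom (ρ.i a) y₂).left) → y₁ = y₂ := by
  intro y₁ y₂ h₁ h₂ hiso
  obtain ⟨x₁, rfl⟩ := hfac y₁ h₁
  obtain ⟨x₂, rfl⟩ := hfac y₂ h₂
  rw [Category.assoc] at h₁ h₂
  rw [hT x₁ x₂ h₁ h₂ (exists_tupleIso_of_comp_of_pointwise ℓ 𝒜 ρ D pol lvl 𝒯 ρT DT polT lvlT x₁ x₂ (R x₁ h₁) (R x₂ h₂) hiso)]

end TransportConverse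

end AbelianSchemeOver

end Literature.AlgebraicGeometry.AbelianSchemes

end
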